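import Mathlib

/-!
# Crux-triage scratch — stmt-Langlands-12919 (ReducibleOrdinaryProModular), round 1, triager 1

Reconstruction (the ideator's `Sketch.generic_point_criterion` is not readable from this jail) of the
commutative-algebra lever of idea `generic-eisenstein-rigidity`: the Berger–Klosin principal-ideal
criterion (BK13 = arXiv:1103.5100, Thm. 49 / Prop. 51) relocated from a finite flat `𝒪`-algebra to an
ARBITRARY Noetherian local base (the local ring `R_η ↠ T_η` at the generic point `η` of an Eisenstein
divisor), where "S finitely generated free over 𝒪" is replaced by the one hypothesis that is actually
used: the generator `x` of the reducibility ideal maps to a NON-ZERO-DIVISOR of `S` (i.e. no Eisenstein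
= everywhere-reducible component of `Spec T` passes through `η`).
-/

namespace CruxTriage.ReducibleOrdinaryProModular

open Ideal

/-- **Generic-point criterion (regular-element form).**  Let `φ : R → S` be a ring map with `R`
Noetherian, `x ∈ Jac(R)`, `φ x` a non-zero-divisor of `S`, and suppose the induced map
`R/(x) → S/(φ x)` is injective (for surjective `φ` this is the Berger–Klosin length inequality
`ℓ(R/(x)) ≤ ℓ(S/(φ x)) < ∞`).  Then `φ` is injective; hence a surjective such `φ` is an isomorphism. -/
theorem ker_eq_bot_of_regular_generator {R S : Type*} [CommRing R] [CommRing S] [IsNoetherianRing R]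
    (φ : R →+* S) (x : R) (hx : Ideal.span {x} ≤ (⊥ : Ideal R).jacobson)
    (hreg : ∀ s : S, φ x * s = 0 → s = 0)
    (h1 : ∀ r : R, φ r ∈ Ideal.span {φ x} → r ∈ Ideal.span {x}) :
    RingHom.ker φ = ⊥ := by
  set K : Ideal R := RingHom.ker φ with hK
  have hfg : K.FG := (isNoetherianRing_iff_ideal_fg R).mp inferInstance K
  -- K ≤ (x) • K
  have hle : K ≤ Ideal.span {x} • K := by
    intro k hk
    have hk0 : φ k = 0 := hk
    have hkx : k ∈ Ideal.span {x} := h1 k (by simp [hk0])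
    obtain ⟨r, rfl⟩ := Ideal.mem_span_singleton'.mp hkx
    have hr : φ r = 0 := by
      apply hreg
      have : φ (r * x) = 0 := hk0
      simpa [map_mul, mul_comm] using this
    have hrK : r ∈ K := hr
    have hxr : x * r ∈ Ideal.span {x} * K :=
      Ideal.mul_mem_mul (Ideal.mem_span_singleton_self x) hrK
    have : r * x ∈ Ideal.span {x} * K := by simpa [mul_comm] using hxr
    simpa [Ideal.smul_eq_mul] using this
  exact Submodule.eq_bot_of_le_smul_of_le_jacobson_bot (Ideal.span {x}) K hfg hle hx

/-- Surjective version: under the same hypotheses a surjection is an isomorphism. -/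
theorem bijective_of_regular_generator {R S : Type*} [CommRing R] [CommRing S] [IsNoetherianRing R]
    (φ : R →+* S) (hφ : Function.Surjective φ) (x : R)
    (hx : Ideal.span {x} ≤ (⊥ : Ideal R).jacobson)
    (hreg : ∀ s : S, φ x * s = 0 → s = 0)
    (h1 : ∀ r : R, φ r ∈ Ideal.span {φ x} → r ∈ Ideal.span {x}) :
    Function.Bijective φ :=
  ⟨(RingHom.injective_iff_ker_eq_bot φ).mpr (ker_eq_bot_of_regular_generator φ x hx hreg h1), hφ⟩

/-- In a local ring every element of the maximal ideal satisfies the Jacobson hypothesis above. -/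
theorem span_le_jacobson_bot_of_mem_maximalIdeal {R : Type*} [CommRing R] [IsLocalRing R]
    (x : R) (hx : x ∈ IsLocalRing.maximalIdeal R) :
    Ideal.span {x} ≤ (⊥ : Ideal R).jacobson := by
  rw [IsLocalRing.jacobson_eq_maximalIdeal ⊥ bot_ne_top]
  exact (Ideal.span_singleton_le_iff_mem _).mpr hx

/-- **Counting step** behind hypothesis `h1` above (the Berger–Klosin length inequality): a surjective
linear map onto a module of finite length that is at least the length of the source is injective. -/
theorem injective_of_surjective_of_length_le {R M P : Type*} [Ring R] [AddCommGroup M] [Module R M]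
    [AddCommGroup P] [Module R P] (g : M →ₗ[R] P) (hg : Function.Surjective g)
    (hP : Module.length R P ≠ ⊤) (hle : Module.length R M ≤ Module.length R P) :
    Function.Injective g := by
  have h := Module.length_eq_add_of_exact (LinearMap.ker g).subtype g
    (Submodule.subtype_injective _) hg (LinearMap.exact_subtype_ker_map g)
  have hM : Module.length R M ≠ ⊤ := ne_top_of_le_ne_top hP hle
  have hK : Module.length R (LinearMap.ker g) ≠ ⊤ :=
    ne_top_of_le_ne_top hM (Module.length_le_of_injective _ (Submodule.subtype_injective _))
  obtain ⟨n, hn⟩ := ENat.ne_top_iff_exists.mp hP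
  obtain ⟨m, hm⟩ := ENat.ne_top_iff_exists.mp hM
  obtain ⟨k, hk⟩ := ENat.ne_top_iff_exists.mp hK
  rw [← hn, ← hm, ← hk] at h
  rw [← hn, ← hm] at hle
  have h' : m = k + n := by exact_mod_cast h
  have hle' : m ≤ n := by exact_mod_cast hle
  have hk0 : k = 0 := by omega
  have hK0 : Module.length R (LinearMap.ker g) = 0 := by rw [← hk, hk0]; rfl
  have hsub : Subsingleton (LinearMap.ker g) := Module.length_eq_zero_iff.mp hK0
  rw [← LinearMap.ker_eq_bot]
  exact Submodule.eq_bot_iff _ |>.mpr fun y hy => by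
    have := hsub.elim ⟨y, hy⟩ 0
    simpa using congrArg Subtype.val this

end CruxTriage.ReducibleOrdinaryProModular
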